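import Literature.Algebra.Polynomial.CasasAlvero.Degree8Char419Closed
import Literature.Algebra.Polynomial.CasasAlvero.Degree8ScenarioCriterion
import Mathlib.Tactic.NormNum.Prime
import HarnessLib

/-!
# The Casas-Alvero conjecture in degree 8 holds in characteristic 419

This file PROVES, kernel-checked, that `419` is a GOOD prime for degree `8` in the sense of [CastryckLaterveerOunaies2012]
(`CA_8` holds in characteristic `419`):

* `holdsInDegree_eight_of_char_419` — `CA_8` over every field with `419 = 0`: the `876` reduced scenario systems are closed there
  (`degree8ScenariosClosed_of_char_419`, assembled from the kernel-evaluated certificates `Degree8Char419Cert*.lean` via `CertCheck.check`),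
  and the characteristic-free criterion `Degree8ScenariosClosed.holdsInDegree_eight` (`Degree8ScenarioCriterion.lean`) applies;
* `holdsInDegree_eight_mul_pow_of_char_419` — hence `CA_(8·419^k)` over every field of characteristic `419` ([GrafVonBothmerEtAl2007, Prop. 6] + descent).

With `CharFourHundredNineteenPartial.lean` / `CharFourHundredFortyThreePartial.lean` this completes the classification of Casas-Alvero degrees in
characteristic `419` (`CharFourHundredNineteenComplete.lean`).  The certificates were found by linear algebra over `F_419` (lottery cell `code/L4lean-g15/d8/certD.py`,
kit job j133389) and are re-verified by the kernel; an independent Gröbner-basis implementation (`implB_groebnerd.py`) reports every scenario closed at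
`p = 419` as well.  No `sorry`, no new axioms.
-/

set_option linter.style.longLine false

noncomputable section

open Polynomial

namespace Literature.Algebra.Polynomial.CasasAlvero

variable {K : Type*} [Field K]

/-- **`CA_8` in characteristic `419`.**  Over every field in which `419 = 0`, a monic polynomial of degree `8` each of whose Hasse derivatives
`H_1 f, …, H_7 f` shares a root with `f` is `(X - a)^8`: `419` is a good prime for degree `8` (it is bad for degree `7` (`not_holdsInDegree_seven_of_char_419`)).
[cite: CastryckLaterveerOunaies2012, Sec. 2] -/
theorem holdsInDegree_eight_of_char_419 (hp : (419 : K) = 0) : HoldsInDegree K 8 :=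
  (degree8ScenariosClosed_of_char_419 hp).holdsInDegree_eight

/-- Hence `CA_(8·419^k)` over every field of characteristic `419`. [cite: CastryckLaterveerOunaies2012, Sec. 2] [cite: GrafVonBothmerEtAl2007, Prop. 6] -/
theorem holdsInDegree_eight_mul_pow_of_char_419 [CharP K 419] (k : ℕ) : HoldsInDegree K (8 * 419 ^ k) := by
  haveI : Fact (Nat.Prime 419) := ⟨by norm_num⟩
  exact Degree8ScenariosClosed.holdsInDegree_eight_mul_prime_pow 419
    (degree8ScenariosClosed_of_char_419 (K := AlgebraicClosure K) (by simpa using CharP.cast_eq_zero (AlgebraicClosure K) 419)) k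

end Literature.Algebra.Polynomial.CasasAlvero
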